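import Summits.AtomisticToContinuum.Crystallization.Theorems.ChargedEnergyGapSelfCharge
import Summits.AtomisticToContinuum.Crystallization.Theorems.ChargedEnergyGapLabelledCovering
import HarnessLib

/-!
# Charged energy gap — lens-3 g63, part P-Z₄: every bulk pair has a CARRIER OF MASS AT LEAST ONE HALF

Cell `decomp-a2c`, seat lens-3, generation 63, part P-Z₄ (after P-Z₁ `ChargedEnergyGapLabelledCovering`, P-Z₃ `ChargedEnergyGapSelfCharge`).
ELEMENTARY·PROVED·SCHEME-INDEPENDENT.  `BulkFarResidueBound` (P-Z₃) asks to pay `Σ 6|y − z|⁻⁶` over bulk far pairs (`y ∉ X`,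
`χ(y)·w(y) = 1`; `z ∈ X` far) by shell mass, transition mass and priced-near sites.  This part is the EXISTENCE half of any such
attribution: walking from `y` to `z` through nearest sites of the segment (covering radius `219/100`, P-Z₁; consecutive sites `≤ 439/100`
apart) and stopping at the first excised or low-weight site, one finds a carrier of MASS `≥ 1/2` in its own currency.
§1 quantitative smooth step (`S > 0` on `t > 0`, `S < 1` on `t < 1`, `S(t) ≤ 35t⁴`); §2 profile weight versus distance to the centre
set (`w = 1 ⇒ d ≥ ϱ`, `w = 0 ⇒ d ≤ ϱ/2`, `d < ϱ ⇒ w < 1`, `ϱ/2 < d ⇒ 0 < w`, and the FLAT TOP `ϱ − a ≤ d ⇒ 1 − 140(2a/ϱ)⁴ ≤ w` —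
quartic flatness, no Lipschitz constant); §3 all factors positive `⇒ alive = 1`, and none in transition `⇒ χ = 1`;
§4 `χ ≤` each listed factor; §5 ★ `transitionCarrier_of_adjacent` and ★★ `exists_carrier_of_pair` (`ϱ ≥ 40`, `ϱχ ≥ 10`): a carrier
`c` within `219/100` of the segment and a paying witness `p ∉ X`, `χ(p)w(p) ≥ 1/2`, `dist p c ≤ 439/100`, with (H) `c ∈ X`, or
(T) `c ∉ X` shell with `χ(c) ≥ 1/2`, or (χ) `c ∉ X` transition with `w·alive·mult² ≥ 1/2`.
The LOAD per carrier is P-Z₅ (seat HANDOFF §H: the plain tube sum over-counts; sub-layer / fractional alternatives recorded there).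
-/

noncomputable section

open scoped Classical

open Literature.MathematicalPhysics.StatisticalMechanics Literature.Geometry.DiscreteGeometry
open Summit.AtomisticToContinuum.Crystallization.Theses.PricedLinkCensus
open Summit.AtomisticToContinuum.Crystallization.Theorems.ChargedEnergyGapNegative

namespace Summit.AtomisticToContinuum.Crystallization.Theorems.ChargedEnergyGapChartDial

/-! ## §1 Quantitative smooth step -/

section SmoothStep

/-- The clamped argument of the smooth step lies in `[0, 1]`. [formal bookkeeping] -/
theorem clamp_mem (t : ℝ) : 0 ≤ max 0 (min 1 t) ∧ max 0 (min 1 t) ≤ 1 :=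
  ⟨le_max_left _ _, max_le zero_le_one (min_le_left _ _)⟩

/-- The smooth step is POSITIVE on `t > 0` (its cubic cofactor `35 − 84u + 70u² − 20u³ ≥ 1` on `[0, 1]`). -/
theorem smoothStep_pos {t : ℝ} (ht : 0 < t) : 0 < smoothStep t := by
  obtain ⟨h0, h1⟩ := clamp_mem t
  have hu : 0 < max 0 (min 1 t) := lt_max_of_lt_right (lt_min one_pos ht)
  have hc : 1 ≤ 35 - 84 * max 0 (min 1 t) + 70 * max 0 (min 1 t) ^ 2 - 20 * max 0 (min 1 t) ^ 3 := by
    nlinarith [mul_nonneg h0 (sub_nonneg.2 h1), mul_nonneg (mul_nonneg h0 h0) (sub_nonneg.2 h1)]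
  unfold smoothStep
  exact mul_pos (pow_pos hu 4) (by linarith)

/-- The smooth step is `< 1` on `t < 1` (`1 − S = (1−u)⁴(1 + 4u + 10u² + 20u³)`). -/
theorem smoothStep_lt_one {t : ℝ} (ht : t < 1) : smoothStep t < 1 := by
  obtain ⟨h0, h1⟩ := clamp_mem t
  have hu : max 0 (min 1 t) < 1 := max_lt one_pos (min_lt_of_right_lt ht |>.trans_le le_rfl)
  have key : 1 - smoothStep t =
      (1 - max 0 (min 1 t)) ^ 4 * (1 + 4 * max 0 (min 1 t) + 10 * max 0 (min 1 t) ^ 2 + 20 * max 0 (min 1 t) ^ 3) := by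
    simp only [smoothStep]; ring
  have hpos : 0 < 1 - smoothStep t := by
    rw [key]; exact mul_pos (pow_pos (by linarith) 4) (by positivity)
  linarith

/-- The quartic flatness at `0`: `smoothStep t ≤ 35·t⁴` for `t ≥ 0`. -/
theorem smoothStep_le_mul_pow_four {t : ℝ} (ht : 0 ≤ t) : smoothStep t ≤ 35 * t ^ 4 := by
  obtain ⟨h0, h1⟩ := clamp_mem t
  have hut : max 0 (min 1 t) ≤ t := max_le ht (min_le_right _ _)
  have hc : 35 - 84 * max 0 (min 1 t) + 70 * max 0 (min 1 t) ^ 2 - 20 * max 0 (min 1 t) ^ 3 ≤ 35 := by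
    nlinarith [mul_nonneg h0 (sub_nonneg.2 h1), mul_nonneg (mul_nonneg h0 h0) (sub_nonneg.2 h1), mul_nonneg (mul_nonneg h0 h0) h0]
  unfold smoothStep
  calc (max 0 (min 1 t)) ^ 4 * (35 - 84 * max 0 (min 1 t) + 70 * max 0 (min 1 t) ^ 2 - 20 * max 0 (min 1 t) ^ 3)
      ≤ (max 0 (min 1 t)) ^ 4 * 35 := mul_le_mul_of_nonneg_left hc (pow_nonneg h0 4)
    _ ≤ t ^ 4 * 35 := mul_le_mul_of_nonneg_right (pow_le_pow_left₀ h0 hut 4) (by norm_num)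
    _ = 35 * t ^ 4 := by ring

end SmoothStep

/-! ## §2 Profile weights versus the distance to the centre set -/

section Profile

variable {ϱ : ℝ} {C : Set E3} {q : E3}

/-- `w = 1` forces `dist(q, C) ≥ ϱ`. -/
theorem le_infDist_of_profileWeight_eq_one (hϱ : 0 < ϱ) (h : profileWeight ϱ C q = 1) : ϱ ≤ Metric.infDist q C := by
  by_contra hlt
  push Not at hlt
  have harg : 0 < 2 - 2 * Metric.infDist q C / ϱ := by
    rw [sub_pos, div_lt_iff₀ hϱ]; linarith
  have hS := smoothStep_pos harg
  have hle : profileWeight ϱ C q ≤ (1 - smoothStep (2 - 2 * Metric.infDist q C / ϱ)) ^ 1 := by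
    unfold profileWeight
    exact pow_le_pow_of_le_one (sub_nonneg.2 (smoothStep_le_one _)) (sub_le_self _ (smoothStep_nonneg _)) (by norm_num)
  rw [pow_one] at hle
  linarith

/-- `w = 0` forces `dist(q, C) ≤ ϱ/2`. -/
theorem infDist_le_of_profileWeight_eq_zero (hϱ : 0 < ϱ) (h : profileWeight ϱ C q = 0) : Metric.infDist q C ≤ ϱ / 2 := by
  by_contra hlt
  push Not at hlt
  have harg : 2 - 2 * Metric.infDist q C / ϱ < 1 := by
    have : 1 < 2 * Metric.infDist q C / ϱ := by rw [lt_div_iff₀ hϱ]; linarith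
    linarith
  have hS := smoothStep_lt_one harg
  unfold profileWeight at h
  have h1 : 1 - smoothStep (2 - 2 * Metric.infDist q C / ϱ) = 0 := pow_eq_zero_iff (by norm_num) |>.1 h
  linarith

/-- `dist(q, C) < ϱ` forces `w < 1`. -/
theorem profileWeight_lt_one_of_infDist_lt (hϱ : 0 < ϱ) (h : Metric.infDist q C < ϱ) : profileWeight ϱ C q < 1 := by
  by_contra hge
  exact absurd (le_infDist_of_profileWeight_eq_one hϱ (le_antisymm (profileWeight_le_one ϱ C q) (not_lt.1 hge))) (not_le.2 h)

/-- `ϱ/2 < dist(q, C)` forces `0 < w`. -/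
theorem profileWeight_pos_of_lt_infDist (hϱ : 0 < ϱ) (h : ϱ / 2 < Metric.infDist q C) : 0 < profileWeight ϱ C q := by
  by_contra hle
  exact absurd (infDist_le_of_profileWeight_eq_zero hϱ (le_antisymm (not_lt.1 hle) (profileWeight_nonneg ϱ C q))) (not_le.2 h)

/-- ★ The FLAT TOP of the profile: `ϱ − a ≤ dist(q, C)` gives `1 − 140·(2a/ϱ)⁴ ≤ w(q)` — quartic flatness, no Lipschitz constant. -/
theorem profileWeight_ge_of_le_infDist (hϱ : 0 < ϱ) {a : ℝ} (h : ϱ - a ≤ Metric.infDist q C) :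
    1 - 140 * (2 * a / ϱ) ^ 4 ≤ profileWeight ϱ C q := by
  set x := 2 - 2 * Metric.infDist q C / ϱ with hx
  have hxa : x ≤ 2 * a / ϱ := by
    have h1 : 2 * (ϱ - a) / ϱ ≤ 2 * Metric.infDist q C / ϱ := by gcongr
    have h2 : 2 * (ϱ - a) / ϱ = 2 - 2 * a / ϱ := by field_simp
    rw [hx]; linarith
  have hS0 := smoothStep_nonneg x
  have hS1 := smoothStep_le_one x
  have hS : smoothStep x ≤ 35 * (2 * a / ϱ) ^ 4 := by
    by_cases hx0 : x ≤ 0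
    · rw [smoothStep_of_le_zero hx0]; positivity
    · push Not at hx0
      exact (smoothStep_le_mul_pow_four hx0.le).trans (by gcongr)
  have hB : 1 - 4 * smoothStep x ≤ (1 - smoothStep x) ^ 4 := by nlinarith [mul_nonneg hS0 hS0, mul_nonneg (mul_nonneg hS0 hS0) hS0]
  unfold profileWeight
  rw [← hx]
  linarith

end Profile

/-! ## §3 All factors positive ⇒ alive `= 1`; and none in transition ⇒ `χ = 1` -/

section Alive

variable {ϱχ : ℝ} {m : ℕ} {D : Fin m → Set E3} {σ : Fin m → Bool}

/-- If every factor is POSITIVE and NO listed set is in transition at `y`, then `χ(y) = 1`. -/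
theorem localFactor_eq_one_of_pos_of_transMult_eq_zero {y : E3}
    (hpos : ∀ i, 0 < (if σ i then profileWeight ϱχ (D i) y else 1 - profileWeight ϱχ (D i) y)) (h : transMult ϱχ D y = 0) :
    localFactor ϱχ D σ y = 1 := by
  rcases localFactor_eq_zero_or_one_of_transMult_eq_zero (σ := σ) h with h0 | h1
  · exfalso
    unfold localFactor at h0
    obtain ⟨i, _, hi⟩ := Finset.prod_eq_zero_iff.1 h0
    exact absurd hi (hpos i).ne'
  · exact h1

/-- If every factor is positive at `y`, the alive indicator is `1`. -/
theorem aliveFactor_eq_one_of_pos {y : E3}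
    (hpos : ∀ i, 0 < (if σ i then profileWeight ϱχ (D i) y else 1 - profileWeight ϱχ (D i) y)) : aliveFactor ϱχ D σ y = 1 := by
  unfold aliveFactor
  refine Finset.prod_eq_one fun i _ => ?_
  by_cases ht : InTransition ϱχ D i y
  · simp [ht]
  · rw [if_neg ht]
    exact (factor_eq_zero_or_one_of_not_inTransition (σ := σ) ht).resolve_left (hpos i).ne'

/-- If all factors are positive and `χ(y) < 1` then SOME listed set is in transition at `y`. -/
theorem one_le_transMult_of_pos_of_localFactor_lt_one {y : E3}
    (hpos : ∀ i, 0 < (if σ i then profileWeight ϱχ (D i) y else 1 - profileWeight ϱχ (D i) y)) (hlt : localFactor ϱχ D σ y < 1) :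
    1 ≤ transMult ϱχ D y := by
  by_contra h
  have h0 : transMult ϱχ D y = 0 := by omega
  have := localFactor_eq_one_of_pos_of_transMult_eq_zero hpos h0
  linarith

end Alive


/-! ## §4 Listed factors: bounds, and `χ ≤` each factor -/

section Factors

variable {ϱχ : ℝ} {m : ℕ} {D : Fin m → Set E3} {σ : Fin m → Bool}

/-- Each listed factor is non-negative … [formal bookkeeping; P-U's version is private] -/
theorem listFactor_nonneg (i : Fin m) (y : E3) : 0 ≤ (if σ i then profileWeight ϱχ (D i) y else 1 - profileWeight ϱχ (D i) y) := by
  split_ifs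
  · exact profileWeight_nonneg _ _ _
  · exact sub_nonneg.2 (profileWeight_le_one _ _ _)

/-- … and at most `1`. -/
theorem listFactor_le_one (i : Fin m) (y : E3) : (if σ i then profileWeight ϱχ (D i) y else 1 - profileWeight ϱχ (D i) y) ≤ 1 := by
  split_ifs
  · exact profileWeight_le_one _ _ _
  · exact sub_le_self _ (profileWeight_nonneg _ _ _)

/-- The localisation factor is at most each of its factors. -/
theorem localFactor_le_listFactor (i : Fin m) (y : E3) :
    localFactor ϱχ D σ y ≤ (if σ i then profileWeight ϱχ (D i) y else 1 - profileWeight ϱχ (D i) y) := by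
  unfold localFactor
  rw [← Finset.mul_prod_erase Finset.univ _ (Finset.mem_univ i)]
  have h1 : (∏ j ∈ Finset.univ.erase i, if σ j then profileWeight ϱχ (D j) y else 1 - profileWeight ϱχ (D j) y) ≤ 1 :=
    Finset.prod_le_one (fun j _ => listFactor_nonneg j y) (fun j _ => listFactor_le_one j y)
  have h0 := listFactor_nonneg (ϱχ := ϱχ) (D := D) (σ := σ) i y
  nlinarith

end Factors

/-! ## §5 The transition carrier next to a bulk site, and ★★ the carrier of a bulk pair -/

section Carrier

variable {ϱχ : ℝ} {m : ℕ} {D : Fin m → Set E3} {σ : Fin m → Bool} {P : PeriodicConfiguration 3} {X : Set E3} {ϱ : ℝ} {C : Set E3}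

/-- ★ THE TRANSITION CARRIER NEXT TO A BULK SITE: if `p` has `w(p) = 1` and `χ(p) = 1` and `p'` within `439/100` has paying weight `< 1/2`, then
(`ϱ ≥ 40`, `ϱχ ≥ 10`) some listed set is in transition at `p'` and `w(p')·alive(p')·mult(p')² ≥ 1/2` — by the flat tops of the profiles. -/
theorem transitionCarrier_of_adjacent (hϱ : 40 ≤ ϱ) (hϱχ : 10 ≤ ϱχ) {p p' : E3} (hd : dist p' p ≤ 439 / 100)
    (hw : profileWeight ϱ C p = 1) (hχ : localFactor ϱχ D σ p = 1) (hg' : localFactor ϱχ D σ p' * profileWeight ϱ C p' < 1 / 2) :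
    1 ≤ transMult ϱχ D p' ∧ 1 / 2 ≤ profileWeight ϱ C p' * aliveFactor ϱχ D σ p' * (transMult ϱχ D p' : ℝ) ^ 2 := by
  have hϱ0 : 0 < ϱ := by linarith
  have hϱχ0 : 0 < ϱχ := by linarith
  have hdC : ϱ - 439 / 100 ≤ Metric.infDist p' C := by
    have h1 := le_infDist_of_profileWeight_eq_one hϱ0 hw
    have h2 : Metric.infDist p C ≤ Metric.infDist p' C + dist p p' := Metric.infDist_le_infDist_add_dist
    rw [dist_comm] at h2
    linarith
  have hw' : 1 / 2 ≤ profileWeight ϱ C p' := by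
    have h := profileWeight_ge_of_le_infDist hϱ0 hdC
    have hr : 2 * (439 / 100 : ℝ) / ϱ ≤ 439 / 2000 := by rw [div_le_iff₀ hϱ0]; linarith
    have hr0 : 0 ≤ 2 * (439 / 100 : ℝ) / ϱ := by positivity
    have h4 : (2 * (439 / 100 : ℝ) / ϱ) ^ 4 ≤ (439 / 2000) ^ 4 := pow_le_pow_left₀ hr0 hr 4
    nlinarith
  have hfac : ∀ i, (if σ i then profileWeight ϱχ (D i) p else 1 - profileWeight ϱχ (D i) p) = 1 := fun i => by
    have h := localFactor_le_listFactor (ϱχ := ϱχ) (D := D) (σ := σ) i p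
    rw [hχ] at h
    exact le_antisymm (listFactor_le_one i p) h
  have hpos : ∀ i, 0 < (if σ i then profileWeight ϱχ (D i) p' else 1 - profileWeight ϱχ (D i) p') := by
    intro i
    have hi := hfac i
    have hdd : Metric.infDist p (D i) ≤ Metric.infDist p' (D i) + dist p p' := Metric.infDist_le_infDist_add_dist
    have hdd' : Metric.infDist p' (D i) ≤ Metric.infDist p (D i) + dist p' p := Metric.infDist_le_infDist_add_dist
    rw [dist_comm] at hdd
    by_cases hσ : σ i = true
    · rw [if_pos hσ] at hi ⊢
      have h1 := le_infDist_of_profileWeight_eq_one hϱχ0 hi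
      have h2 : ϱχ / 2 < Metric.infDist p' (D i) := by linarith
      exact profileWeight_pos_of_lt_infDist hϱχ0 h2
    · rw [if_neg hσ] at hi ⊢
      have hw0 : profileWeight ϱχ (D i) p = 0 := by linarith
      have h1 := infDist_le_of_profileWeight_eq_zero hϱχ0 hw0
      have h2 : Metric.infDist p' (D i) < ϱχ := by linarith
      have := profileWeight_lt_one_of_infDist_lt hϱχ0 h2
      linarith
  have halive := aliveFactor_eq_one_of_pos hpos
  have hχ'lt : localFactor ϱχ D σ p' < 1 := by
    by_contra hge
    have h1 : localFactor ϱχ D σ p' = 1 := le_antisymm (localFactor_le_one (ϱχ := ϱχ) (D := D) (σ := σ) p') (not_lt.1 hge)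
    rw [h1, one_mul] at hg'
    linarith
  have hmult := one_le_transMult_of_pos_of_localFactor_lt_one hpos hχ'lt
  refine ⟨hmult, ?_⟩
  have hm1 : (1 : ℝ) ≤ (transMult ϱχ D p' : ℝ) := by exact_mod_cast hmult
  rw [halive, mul_one]
  nlinarith

/-- ★★ **THE CARRIER OF A BULK PAIR** (scheme-independent existence half of the bulk far-residue attribution).  On a `(lam ≤ 1/3, ℓ ≥ 3)`-labelled
reference (covering radius `219/100`, P-Z₁) with `ϱ ≥ 40`, `ϱχ ≥ 10`: for every site `y ∉ X` of paying weight `χ(y)·w(y) ≥ 1/2` and every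
excised site `z`, there are a CARRIER site `c` within `219/100` of a point `y + t(z − y)` (`0 ≤ t ≤ 1`) of the segment and a PAYING WITNESS site
`p ∉ X`, `χ(p)·w(p) ≥ 1/2`, `dist p c ≤ 439/100`, such that (H) `c ∈ X` — so `c` is priced-near whenever `439/100 < 3ϱ/8` —, or (T) `c ∉ X` is a
SHELL site (`0 < w(c) < 1`) with `χ(c) ≥ 1/2`, or (χ) `c ∉ X` is a TRANSITION site (`mult(c) ≥ 1`) with `w(c)·alive(c)·mult(c)² ≥ 1/2`.
Proof: walk the chain of nearest sites along the segment (step `≤ 439/100`) and stop at the first excised or low-weight site. -/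
theorem exists_carrier_of_pair {lam ℓ : ℝ} (hL : IsLabelledRef lam ℓ P) (hlam : lam ≤ 1 / 3) (hℓ : 3 ≤ ℓ) (hϱ : 40 ≤ ϱ) (hϱχ : 10 ≤ ϱχ)
    {y z : E3} (hy : y ∈ P.points) (hyX : y ∉ X) (hgy : 1 / 2 ≤ localFactor ϱχ D σ y * profileWeight ϱ C y)
    (hz : z ∈ P.points) (hzX : z ∈ X) :
    ∃ c ∈ P.points, ∃ p ∈ P.points, ∃ t : ℝ, 0 ≤ t ∧ t ≤ 1 ∧ dist c (y + t • (z - y)) ≤ 219 / 100 ∧ dist p c ≤ 439 / 100 ∧ p ∉ X ∧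
      1 / 2 ≤ localFactor ϱχ D σ p * profileWeight ϱ C p ∧
      (c ∈ X ∨
        (c ∉ X ∧ 0 < profileWeight ϱ C c ∧ profileWeight ϱ C c < 1 ∧ 1 / 2 ≤ localFactor ϱχ D σ c) ∨
        (c ∉ X ∧ 1 ≤ transMult ϱχ D c ∧ 1 / 2 ≤ profileWeight ϱ C c * aliveFactor ϱχ D σ c * (transMult ϱχ D c : ℝ) ^ 2)) := by
  choose f hf using fun w : E3 => hL.exists_dist_le hlam hℓ w
  set N : ℕ := ⌈100 * dist y z⌉₊ + 1 with hN
  have hN1 : 1 ≤ N := by omega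
  have hNpos : (0 : ℝ) < N := by exact_mod_cast hN1
  have hNd : 100 * dist y z ≤ (N : ℝ) := by
    have h1 := Nat.le_ceil (100 * dist y z)
    have h2 : ((⌈100 * dist y z⌉₊ + 1 : ℕ) : ℝ) = (⌈100 * dist y z⌉₊ : ℝ) + 1 := by push_cast; ring
    rw [hN, h2]
    linarith
  set q : ℕ → E3 := fun k => y + ((k : ℝ) / N) • (z - y) with hq
  set pk : ℕ → E3 := fun k => if k = 0 then y else if N ≤ k then z else f (q k) with hpk
  have hq0 : q 0 = y := by simp [hq]
  have hqN : q N = z := by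
    simp only [hq, div_self hNpos.ne', one_smul]
    abel
  have hp_mem : ∀ k, pk k ∈ P.points := by
    intro k
    simp only [hpk]
    split_ifs
    · exact hy
    · exact hz
    · exact (hf _).1
  have hp_dist : ∀ k ≤ N, dist (pk k) (q k) ≤ 219 / 100 := by
    intro k hk
    simp only [hpk]
    split_ifs with h0 hkN
    · rw [h0, hq0, dist_self]; norm_num
    · obtain rfl : k = N := le_antisymm hk hkN
      rw [hqN, dist_self]; norm_num
    · rw [dist_comm]; exact (hf _).2
  have hq_step : ∀ k : ℕ, dist (q k) (q (k + 1)) ≤ 1 / 100 := by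
    intro k
    have hv : q k - q (k + 1) = (-(1 / (N : ℝ))) • (z - y) := by
      simp only [hq]
      rw [add_sub_add_left_eq_sub, ← sub_smul]
      congr 1
      push_cast
      field_simp
      ring
    rw [dist_eq_norm, hv, norm_smul, norm_neg, norm_div, norm_one, Real.norm_of_nonneg hNpos.le, ← dist_eq_norm, dist_comm z y,
      div_mul_eq_mul_div, one_mul, div_le_iff₀ hNpos]
    linarith
  have hp_step : ∀ k, k + 1 ≤ N → dist (pk (k + 1)) (pk k) ≤ 439 / 100 := by
    intro k hk
    calc dist (pk (k + 1)) (pk k) ≤ dist (pk (k + 1)) (q (k + 1)) + dist (q (k + 1)) (q k) + dist (q k) (pk k) := dist_triangle4 _ _ _ _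
      _ ≤ 219 / 100 + 1 / 100 + 219 / 100 := by
          gcongr
          · exact hp_dist (k + 1) hk
          · rw [dist_comm]; exact hq_step k
          · rw [dist_comm]; exact hp_dist k (by omega)
      _ = 439 / 100 := by norm_num
  have hex : ∃ k, k ≤ N ∧ (pk k ∈ X ∨ localFactor ϱχ D σ (pk k) * profileWeight ϱ C (pk k) < 1 / 2) := by
    refine ⟨N, le_rfl, Or.inl ?_⟩
    simp only [hpk]
    rw [if_neg (by omega), if_pos le_rfl]
    exact hzX
  obtain ⟨hk₀N, hk₀⟩ := Nat.find_spec hex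
  have hk₀min : ∀ k < Nat.find hex, ¬ (k ≤ N ∧ (pk k ∈ X ∨ localFactor ϱχ D σ (pk k) * profileWeight ϱ C (pk k) < 1 / 2)) :=
    fun k hk => Nat.find_min hex hk
  have hk₀pos : Nat.find hex ≠ 0 := by
    intro h0
    have h1 := hk₀
    rw [h0] at h1
    have hy0 : pk 0 = y := by simp [hpk]
    rw [hy0] at h1
    rcases h1 with h1 | h1
    · exact hyX h1
    · linarith
  obtain ⟨j, hj'⟩ := Nat.exists_eq_succ_of_ne_zero hk₀pos
  have hj : Nat.find hex = j + 1 := hj'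
  have hjN : j + 1 ≤ N := by have h := hk₀N; rw [hj] at h; exact h
  have hgood := hk₀min j (by omega)
  push Not at hgood
  obtain ⟨hjX, hjg⟩ := hgood (by omega)
  have hstep := hp_step j hjN
  rw [← hj] at hstep
  have hwj1 := profileWeight_le_one ϱ C (pk j)
  have hwj0 := profileWeight_nonneg ϱ C (pk j)
  have hχj0 := localFactor_nonneg (ϱχ := ϱχ) (D := D) (σ := σ) (pk j)
  have hχj : 1 / 2 ≤ localFactor ϱχ D σ (pk j) := by nlinarith
  have htj : (0 : ℝ) ≤ (j : ℝ) / N ∧ (j : ℝ) / N ≤ 1 :=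
    ⟨by positivity, by rw [div_le_one hNpos]; exact_mod_cast (by omega : j ≤ N)⟩
  have htk : (0 : ℝ) ≤ ((Nat.find hex : ℕ) : ℝ) / N ∧ ((Nat.find hex : ℕ) : ℝ) / N ≤ 1 :=
    ⟨by positivity, by rw [div_le_one hNpos]; exact_mod_cast hk₀N⟩
  by_cases hcX : pk (Nat.find hex) ∈ X
  · exact ⟨pk (Nat.find hex), hp_mem _, pk j, hp_mem _, ((Nat.find hex : ℕ) : ℝ) / N, htk.1, htk.2, hp_dist _ hk₀N,
      by rw [dist_comm]; exact hstep, hjX, hjg, Or.inl hcX⟩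
  · have hclow := hk₀.resolve_left hcX
    by_cases hwlt : profileWeight ϱ C (pk j) < 1
    · have hwpos : 0 < profileWeight ϱ C (pk j) := by
        by_contra hle
        have h0 : profileWeight ϱ C (pk j) = 0 := le_antisymm (not_lt.1 hle) hwj0
        rw [h0, mul_zero] at hjg
        linarith
      exact ⟨pk j, hp_mem _, pk j, hp_mem _, (j : ℝ) / N, htj.1, htj.2, hp_dist j (by omega), by rw [dist_self]; norm_num, hjX, hjg,
        Or.inr (Or.inl ⟨hjX, hwpos, hwlt, hχj⟩)⟩
    · have hw1 : profileWeight ϱ C (pk j) = 1 := le_antisymm hwj1 (not_lt.1 hwlt)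
      by_cases hm : transMult ϱχ D (pk j) = 0
      · have hχ1 : localFactor ϱχ D σ (pk j) = 1 := by
          rcases localFactor_eq_zero_or_one_of_transMult_eq_zero (σ := σ) hm with h0 | h1
          · linarith
          · exact h1
        obtain ⟨hmult, hmass⟩ := transitionCarrier_of_adjacent hϱ hϱχ hstep hw1 hχ1 hclow
        exact ⟨pk (Nat.find hex), hp_mem _, pk j, hp_mem _, ((Nat.find hex : ℕ) : ℝ) / N, htk.1, htk.2, hp_dist _ hk₀N,
          by rw [dist_comm]; exact hstep, hjX, hjg, Or.inr (Or.inr ⟨hcX, hmult, hmass⟩)⟩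
      · have hmult : 1 ≤ transMult ϱχ D (pk j) := by omega
        have halive := localFactor_le_aliveFactor (ϱχ := ϱχ) (D := D) (σ := σ) (pk j)
        have ha0 := aliveFactor_nonneg (ϱχ := ϱχ) (D := D) (σ := σ) (pk j)
        have hm1 : (1 : ℝ) ≤ (transMult ϱχ D (pk j) : ℝ) := by exact_mod_cast hmult
        refine ⟨pk j, hp_mem _, pk j, hp_mem _, (j : ℝ) / N, htj.1, htj.2, hp_dist j (by omega), by rw [dist_self]; norm_num, hjX, hjg,
          Or.inr (Or.inr ⟨hjX, hmult, ?_⟩)⟩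
        rw [hw1, one_mul]
        nlinarith [mul_nonneg ha0 (by nlinarith : (0 : ℝ) ≤ (transMult ϱχ D (pk j) : ℝ) ^ 2 - 1)]

end Carrier

end Summit.AtomisticToContinuum.Crystallization.Theorems.ChargedEnergyGapChartDial

end
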